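/-
Copyright: the b2b-balaban cell (near-miss cell 7), T⁴-continuum fan-out; row NE7b ROUND-2 swarm, seat
t4-ne7b-formalise-leaf-02 (gen 5) — supplier piece for the S6g′ INSTANCE's T3b «injection» (owner's ruling
R-OWNER-22-23, holder leaf-05 g3): the ρ-tie-break at one join (journal OFFER l.12271, accepted by the instance seat
l.12347 «file as specified»).  A supplier module consumed BY NAME; not a claim of T3b.  Released under the licence of the surrounding project.
-/
import Summits.QuantumFields.BalabanUV.T4Continuum.Support.HistoryJoinsCount
import Summits.QuantumFields.BalabanUV.T4Continuum.Support.HistoryTouchIndex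

/-!
# Sibling symmetry, part 4′: the SORTED REPRESENTATIVE EXISTS (the ρ-tie-break at one join)

Summits-side support leaf of the T⁴-continuum cell (rung (B)+1 on a FINITE torus only; NOT infinite volume, NOT the
mass gap, NOT the Clay statement; NOT a proof of the spine estimate NE7b).  Row NE7b, route «COUNT», row S6g′
INSTANCE, piece T3b (R-OWNER-22-23): under wiring (α′) (R-OWNER-22-22 (3)) the histories read into a slot inject into
the count's set `HistoryJoinsAdm.S … (sorted twin) x` by «history ↦ its ρ-TIE-BROKEN sorted placed tree» — at every
join equal sub-trees are interchangeable and only the placement data permute, «which the tie-break by `ρ`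
canonicalises».  Leaf-05 g2's `HistorySiblingCanon` (p212243) has the UNIQUENESS half (`eq_one_of_sorted_smul`) and
the counting; this file proves the EXISTENCE half and packages it with forest admissibility, down to the count's own
top-join carriers.  [folklore] finite combinatorics (`Finset.orderIsoOfFin`); nothing is quoted from print, nothing
printed is asserted, no `[cite:]` tag, no `Prop`-valued fact minted, no definition.  Imports leaf-05 g2's
`HistoryJoinsCount` (carrying `HistoryJoinsAdm`, `HistorySiblingCanon`) and gen 3's `HistoryTouchIndex` only.

WHAT (parts `I` linearly ordered, key `key : I → K`, positions `Pos`, root read-out `ρ : Pos → R` into a linear order;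
`keyPerms`∕`(σ • c) i = c (σ⁻¹ i)`∕`RootInj`∕`Sorted`∕`ForestAdm` BY NAME).
* §1 `exists_fibre_sort` (within each `key`-fibre match the order-rank of a part with the rank of its target value,
  two `orderIsoOfFin`s) ⇒ **`exists_sorted_smul`** `RootInj key ρ c → ∃ σ : keyPerms key, Sorted key ρ (σ • c)`,
  **`sorted_smul_unique`**, **`existsUnique_sorted_smul`**; MATCHING FORM **`exists_sorted_matching`** ∕
  **`sorted_matching_unique`** (realised parts `J` with classes and data, ANY class-respecting matching `J ≃ I` ⇒ the
  unique one whose placed configuration is sorted); `rootInj_of_ne_host`.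
* §2 `forestAdm_smul` (leaf-05 g2's `forestAdm_comp_perm` under the hypotheses of its `smul_mem_forestInj` verbatim),
  `smul_apply_host`, `forestAdm_enrich` (`touch0` dress → `touchJ` dress), **`exists_forestAdm_sorted_smul`**:
  `ForestAdm ok touch h c → RootInj key ρ c → ∃ σ, (σ • c) h = c h ∧ ForestAdm ok touch h (σ • c) ∧ Sorted key ρ (σ • c)`
  — the conjunction of `HistoryJoinsAdm.LocalTop` at one join.
* §3 `forestAdm_of_connected` (gen 3's `exists_contactIndex_symm` + leaf-05 g2's `forestAdm_of_chain`) ⇒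
  **`exists_forestAdm_sorted_smul_of_connected`**: connected (symmetric) contact of the PLACED parts from the host +
  admissible non-host parts + distinct root read-outs ⇒ such a relabelling.
* §4 AT THE TOP JOIN OF A MERGER (`HistoryJoinsAdm.key`∕`hostIdx`∕`touch0`, host alone in its class by
  `eq_host_of_key_eq`): `touch0_iff_of_key_eq`, `touch0_symm`, **`exists_localTop_smul`**,
  **`exists_localTop_smul_of_connected`**, and **`exists_localTopJ_smul_of_connected`** — the `okJ`∕`touchJ` dress
  of `HistoryJoinsCount` (the instance seat's stated instantiation, journal l.12347) when every part is admissibly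
  placed.  §5 sanity on `Fin 3`.

HONEST SCOPE.  §1–§3 abstract finite types, §4 the count's top-join carriers; the binding to realised part data
(placement value = cell × region template per F-leaf05g3-2, `ρ` = a read-out of the root datum, `RootInj` from the
disjointness of realised regions), the recursion over joins ∕ addresses and the injectivity on the slot are T3b proper
(its holder's), NOT here.  Nothing of H3∕(B)∕BetaPertH touched; `BirthShapeNodup` NOT retired by this file; NE7b NOT
proved; spine 0∕9.  HONEST DEPENDENCY (cell): continuum YM on T⁴ ⇐ BetaPertH ∧ nine spine estimates (0/9 proved);
BetaPertH ⇐ (D1) ∧ (D4) ∧ CAP+tail; G-an2-4 gates asym, D1 and NE2/3/4.  This file changes none of it.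
-/

open Finset
open Summit.QuantumFields.BalabanUV.T4Continuum.HistorySiblingSymmetry
open Summit.QuantumFields.BalabanUV.T4Continuum.HistorySiblingOrbits
open Summit.QuantumFields.BalabanUV.T4Continuum.HistorySiblingCanon

namespace Summit.QuantumFields.BalabanUV.T4Continuum.HistorySiblingCanonExist

section Abstract

variable {I K Pos R : Type*} [LinearOrder I] [Fintype I] [LinearOrder R]

/-! ## §1 The sorted representative exists (and is unique) -/

section Exist

variable (key : I → K) (ρ : Pos → R)

/-- **SORTING WITHIN FIBRES.**  For a root-injective configuration `c` there is a key-preserving, injective self-map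
`g` of the parts along which `ρ ∘ c` increases within every fibre of `key` (the part of order-rank `r` in its fibre is
sent to the part carrying the `r`-th smallest value of `ρ ∘ c` on that fibre). [folklore] -/
theorem exists_fibre_sort {c : I → Pos} (hc : RootInj key ρ c) :
    ∃ g : I → I, Function.Injective g ∧ (∀ i, key (g i) = key i) ∧
      ∀ i j, key i = key j → i < j → ρ (c (g i)) < ρ (c (g j)) := by
  classical
  -- the fibres of `key` and their value sets under `v := ρ ∘ c`
  let F : K → Finset I := fun k => univ.filter fun i => key i = k
  have hmemF : ∀ {k : K} {i : I}, i ∈ F k ↔ key i = k := fun {k i} => by simp [F]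
  let v : I → R := fun i => ρ (c i)
  have hinj : ∀ k, Set.InjOn v ↑(F k) := by
    intro k i hi j hj hij
    exact hc i j ((hmemF.1 (mem_coe.1 hi)).trans (hmemF.1 (mem_coe.1 hj)).symm) hij
  let V : K → Finset R := fun k => (F k).image v
  have hV : ∀ k, (V k).card = (F k).card := fun k => card_image_of_injOn (hinj k)
  -- `Fin m ≃o (fibre)` by the order of `I`, `Fin m ≃o (values)` by the order of `R`
  let eI := fun k => (F k).orderIsoOfFin rfl
  let eV := fun k => (V k).orderIsoOfFin (hV k)
  -- every target value is carried by some part of the fibre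
  have hex : ∀ (k : K) (r : Fin (F k).card), ∃ j, j ∈ F k ∧ v j = ((eV k r : ↥(↑(V k) : Set R)) : R) := by
    intro k r
    exact mem_image.1 (mem_coe.1 (eV k r).2)
  choose gk hgkF hgkv using hex
  -- the global self-map
  let g : I → I := fun i => gk (key i) ((eI (key i)).symm ⟨i, mem_coe.2 (hmemF.2 rfl)⟩)
  have hg_eq : ∀ (i : I) (k : K) (hk : key i = k),
      g i = gk k ((eI k).symm ⟨i, mem_coe.2 (hmemF.2 hk)⟩) := by
    intro i k hk
    subst hk
    rfl
  have hgkey : ∀ i, key (g i) = key i := fun i => hmemF.1 (hgkF (key i) _)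
  have hval : ∀ (i : I) (k : K) (hk : key i = k),
      v (g i) = ((eV k ((eI k).symm ⟨i, mem_coe.2 (hmemF.2 hk)⟩) : ↥(↑(V k) : Set R)) : R) := by
    intro i k hk
    rw [hg_eq i k hk]
    exact hgkv k _
  refine ⟨g, ?_, hgkey, ?_⟩
  · intro i j hij
    have hk : key i = key j := by rw [← hgkey i, ← hgkey j, hij]
    have h1 := hval i (key j) hk
    have h2 := hval j (key j) rfl
    have h12 : v (g i) = v (g j) := by
      show ρ (c (g i)) = ρ (c (g j))
      rw [hij]
    have h3 : (eV (key j)) ((eI (key j)).symm ⟨i, mem_coe.2 (hmemF.2 hk)⟩) =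
        (eV (key j)) ((eI (key j)).symm ⟨j, mem_coe.2 (hmemF.2 rfl)⟩) :=
      Subtype.ext (h1.symm.trans (h12.trans h2))
    have h4 := (eI (key j)).symm.injective ((eV (key j)).injective h3)
    exact congrArg Subtype.val h4
  · intro i j hk hij
    show v (g i) < v (g j)
    rw [hval i (key j) hk, hval j (key j) rfl]
    exact Subtype.coe_lt_coe.2
      ((OrderIso.lt_iff_lt _).2 ((OrderIso.lt_iff_lt _).2 (Subtype.mk_lt_mk.2 hij)))

/-- **THE ρ-TIE-BREAK EXISTS**: a root-injective configuration of the parts of a join has a class-preserving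
relabelling that is SORTED (root read-outs increasing along the order of the parts within every shape class).
[folklore] -/
theorem exists_sorted_smul {c : I → Pos} (hc : RootInj key ρ c) : ∃ σ : keyPerms key, Sorted key ρ (σ • c) := by
  classical
  obtain ⟨g, hginj, hgkey, hgmono⟩ := exists_fibre_sort key ρ hc
  have hgbij : Function.Bijective g := Finite.injective_iff_bijective.1 hginj
  let τ : Equiv.Perm I := Equiv.ofBijective g hgbij
  have hτ : ∀ i, τ i = g i := fun _ => rfl
  have hmem : τ.symm ∈ keyPerms key := by
    refine mem_keyPerms.2 fun i => ?_
    have h := hgkey (τ.symm i)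
    rw [← hτ, Equiv.apply_symm_apply] at h
    exact h.symm
  refine ⟨⟨τ.symm, hmem⟩, ?_⟩
  intro i j hk hij
  rw [smul_apply, smul_apply]
  show ρ (c (τ.symm.symm i)) < ρ (c (τ.symm.symm j))
  rw [Equiv.symm_symm, hτ, hτ]
  exact hgmono i j hk hij

/-- **THE ρ-TIE-BREAK IS UNIQUE**: two class-preserving relabellings sorting the same configuration coincide
(leaf-05 g2's `eq_one_of_sorted_smul` applied to `τ·σ⁻¹` on `σ • c`). [folklore] -/
theorem sorted_smul_unique {c : I → Pos} {σ τ : keyPerms key} (hσ : Sorted key ρ (σ • c))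
    (hτ : Sorted key ρ (τ • c)) : σ = τ := by
  have h : (τ * σ⁻¹) • (σ • c) = τ • c := by
    rw [smul_smul, inv_mul_cancel_right]
  have h1 : τ * σ⁻¹ = 1 := eq_one_of_sorted_smul (key := key) (ρ := ρ) hσ (by rw [h]; exact hτ)
  exact (mul_inv_eq_one.1 h1).symm

/-- **THE ρ-TIE-BREAK EXISTS AND IS UNIQUE**: `∃! σ : keyPerms key, Sorted key ρ (σ • c)` for root-injective `c`.
[folklore] -/
theorem existsUnique_sorted_smul {c : I → Pos} (hc : RootInj key ρ c) :
    ∃! σ : keyPerms key, Sorted key ρ (σ • c) := by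
  obtain ⟨σ, hσ⟩ := exists_sorted_smul key ρ hc
  exact ⟨σ, hσ, fun τ hτ => sorted_smul_unique key ρ hτ hσ⟩

/-- **MATCHING FORM** (the shape T3b's injection meets): realised parts `J` with classes `kJ : J → K` and data
`d : J → Pos`, distinct root read-outs within classes, and ANY class-respecting matching `β₀ : J ≃ I` with the slots
(e.g. the one left by a stable sort) ⇒ a class-respecting matching `β` whose placed configuration `d ∘ β⁻¹` is sorted.
[folklore] -/
theorem exists_sorted_matching {J : Type*} (kJ : J → K) (d : J → Pos) (β₀ : J ≃ I) (hβ₀ : ∀ j, key (β₀ j) = kJ j)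
    (hd : ∀ j j', kJ j = kJ j' → ρ (d j) = ρ (d j') → j = j') :
    ∃ β : J ≃ I, (∀ j, key (β j) = kJ j) ∧ Sorted key ρ (d ∘ ⇑β.symm) := by
  have hc : RootInj key ρ (d ∘ ⇑β₀.symm) := by
    intro i i' hk hρ
    have hk' : kJ (β₀.symm i) = kJ (β₀.symm i') := by
      rw [← hβ₀, ← hβ₀, Equiv.apply_symm_apply, Equiv.apply_symm_apply]
      exact hk
    exact β₀.symm.injective (hd _ _ hk' hρ)
  obtain ⟨σ, hσ⟩ := exists_sorted_smul key ρ hc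
  refine ⟨β₀.trans (σ : Equiv.Perm I), fun j => ?_, ?_⟩
  · rw [Equiv.trans_apply, mem_keyPerms.1 σ.2, hβ₀]
  · have hfun : d ∘ ⇑(β₀.trans (σ : Equiv.Perm I)).symm = σ • (d ∘ ⇑β₀.symm) := by
      funext i
      rw [smul_apply, Function.comp_apply, Function.comp_apply, Equiv.symm_trans_apply]
    rw [hfun]
    exact hσ

/-- the matching of `exists_sorted_matching` is UNIQUE: two class-respecting matchings with sorted placed
configurations coincide. [folklore] -/
theorem sorted_matching_unique {J : Type*} (kJ : J → K) (d : J → Pos) {β β' : J ≃ I}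
    (hβ : ∀ j, key (β j) = kJ j) (hβ' : ∀ j, key (β' j) = kJ j)
    (hs : Sorted key ρ (d ∘ ⇑β.symm)) (hs' : Sorted key ρ (d ∘ ⇑β'.symm)) : β = β' := by
  let σ₀ : Equiv.Perm I := β.symm.trans β'
  have hmem : σ₀ ∈ keyPerms key := mem_keyPerms.2 fun i => by
    show key (β' (β.symm i)) = key i
    rw [hβ', ← hβ (β.symm i), Equiv.apply_symm_apply]
  have hsm : (⟨σ₀, hmem⟩ : keyPerms key) • (d ∘ ⇑β.symm) = d ∘ ⇑β'.symm := by
    funext i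
    rw [smul_apply]
    show d (β.symm ((β.symm.trans β').symm i)) = d (β'.symm i)
    rw [Equiv.symm_trans_apply, Equiv.symm_symm, Equiv.symm_apply_apply]
  have h1 : (⟨σ₀, hmem⟩ : keyPerms key) = 1 :=
    eq_one_of_sorted_smul (key := key) (ρ := ρ) hs (by rw [hsm]; exact hs')
  have h2 : σ₀ = 1 := congrArg Subtype.val h1
  ext j
  have h3 := congrArg (fun τ : Equiv.Perm I => τ (β j)) h2
  simp only [σ₀, Equiv.trans_apply, Equiv.symm_apply_apply, Equiv.Perm.coe_one, id_eq] at h3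
  exact h3.symm

omit [Fintype I] [LinearOrder R] in
/-- the hypothesis from the NON-HOST parts: if the host `h` is alone in its class and distinct non-host parts of one
class have distinct root read-outs, the configuration is root-injective. [folklore] -/
theorem rootInj_of_ne_host {h : I} {c : I → Pos} (hkey : ∀ i, key i = key h → i = h)
    (hc : ∀ i j, i ≠ h → j ≠ h → key i = key j → ρ (c i) = ρ (c j) → i = j) : RootInj key ρ c := by
  intro i j hk hρ
  by_cases hi : i = h
  · subst hi
    exact (hkey j hk.symm).symm
  · by_cases hj : j = h
    · subst hj
      exact hkey i hk
    · exact hc i j hi hj hk hρ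

end Exist

/-! ## §2 With forest admissibility: the canonical (forest-admissible, sorted) relabelling exists -/

section Forest

variable {key : I → K} {ρ : Pos → R} {ok : I → Pos → Prop} {touch : I → Pos → I → Pos → Prop} {h : I}

omit [LinearOrder I] [Fintype I] [LinearOrder R] in
/-- forest admissibility is carried by every class-preserving relabelling when the host is alone in its class and
`ok`∕`touch` read the parts through `key` (leaf-05 g2's `forestAdm_comp_perm`; hypotheses of its `smul_mem_forestInj`
verbatim). [folklore] -/
theorem forestAdm_smul (hkey : ∀ i, key i = key h → i = h) (hok : ∀ i j, key i = key j → ∀ p, (ok i p ↔ ok j p))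
    (ht : ∀ i i' j j', key i = key i' → key j = key j' → ∀ p q, (touch i p j q ↔ touch i' p j' q))
    (σ : keyPerms key) {c : I → Pos} (hc : ForestAdm ok touch h c) : ForestAdm ok touch h (σ • c) := by
  rw [smul_eq_comp]
  refine (forestAdm_comp_perm (σ : Equiv.Perm I).symm ?_ (fun i p => ?_) (fun i p j q => ?_) c).2 hc
  · exact hkey _ (key_symm_apply σ h)
  · exact hok _ _ (key_symm_apply σ i) p
  · exact ht _ _ _ _ (key_symm_apply σ i) (key_symm_apply σ j) p q

omit [LinearOrder I] [Fintype I] [LinearOrder R] in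
/-- a class-preserving relabelling fixes the host's position when the host is alone in its class [folklore] -/
theorem smul_apply_host (hkey : ∀ i, key i = key h → i = h) (σ : keyPerms key) (c : I → Pos) :
    (σ • c) h = c h := by
  rw [smul_apply, hkey _ (key_symm_apply σ h)]

omit [LinearOrder I] [Fintype I] [LinearOrder R] in
/-- ENRICHING A FOREST: if every part (host included) is `ok'`-admissible at its position, a forest for (`ok`, `touch`)
is a forest for (`ok'`, «parent `ok'`-admissible ∧ `touch`») along the same parent map — the passage from the
`touch0` dress to leaf-05 g2's `HistoryJoinsCount.touchJ` dress. [folklore] -/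
theorem forestAdm_enrich {ok' : I → Pos → Prop} {c : I → Pos} (hok' : ∀ i, ok' i (c i))
    (hc : ForestAdm ok touch h c) : ForestAdm ok' (fun i p j q => ok' j q ∧ touch i p j q) h c := by
  obtain ⟨par, hac, hpar⟩ := hc
  exact ⟨par, hac, fun i hi => ⟨hok' i, hok' (par i), (hpar i hi).2⟩⟩

/-- **THE CANONICAL RELABELLING EXISTS**: a forest-admissible, root-injective configuration has a class-preserving
relabelling that keeps the host's position, is forest-admissible and is sorted — the conjunction
`ForestAdm … ∧ Sorted key ρ …` of `HistoryJoinsAdm.LocalTop` at one join. [folklore] -/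
theorem exists_forestAdm_sorted_smul (hkey : ∀ i, key i = key h → i = h)
    (hok : ∀ i j, key i = key j → ∀ p, (ok i p ↔ ok j p))
    (ht : ∀ i i' j j', key i = key i' → key j = key j' → ∀ p q, (touch i p j q ↔ touch i' p j' q))
    {c : I → Pos} (hF : ForestAdm ok touch h c) (hc : RootInj key ρ c) :
    ∃ σ : keyPerms key, (σ • c) h = c h ∧ ForestAdm ok touch h (σ • c) ∧ Sorted key ρ (σ • c) := by
  obtain ⟨σ, hσ⟩ := exists_sorted_smul key ρ hc
  exact ⟨σ, smul_apply_host hkey σ c, forestAdm_smul hkey hok ht σ hF, hσ⟩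

end Forest

/-! ## §3 From the order-free datum: connected contact + distinct root read-outs -/

section Connected

variable {key : I → K} {ρ : Pos → R} {ok : I → Pos → Prop} {touch : I → Pos → I → Pos → Prop} {h : I}

omit [LinearOrder I] [Fintype I] [LinearOrder R] in
/-- **CONNECTED CONTACT ⇒ FOREST-ADMISSIBLE** (order-free): if every non-host part is internally admissible, `touch`
is symmetric and the touch graph of the PLACED parts reaches every part from the host, the configuration is
forest-admissible (gen 3's `HistoryTouchIndex.exists_contactIndex_symm` + leaf-05 g2's `forestAdm_of_chain`).
[folklore] -/
theorem forestAdm_of_connected {c : I → Pos} (hokc : ∀ i, i ≠ h → ok i (c i))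
    (hsymm : ∀ i p j q, touch i p j q → touch j q i p)
    (hconn : ∀ i, (SimpleGraph.fromRel fun i j => touch i (c i) j (c j)).Reachable h i) :
    ForestAdm ok touch h c := by
  obtain ⟨idx, -, hidx⟩ := HistoryTouchIndex.exists_contactIndex_symm (fun i j => touch i (c i) j (c j))
    (fun a b hab => hsymm _ _ _ _ hab) h hconn
  exact forestAdm_of_chain ok touch h c idx fun i hi => ⟨hokc i hi, hidx i hi⟩

/-- **CONNECTED CONTACT + DISTINCT ROOT READ-OUTS ⇒ THE CANONICAL RELABELLING EXISTS**: with the host alone in its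
class and `ok`∕`touch` reading the parts through `key`, a configuration whose placed parts have a connected (symmetric)
touch graph from the host, internally admissible non-host parts and distinct root read-outs within classes admits a
class-preserving relabelling that keeps the host's position, is forest-admissible and is sorted. [folklore] -/
theorem exists_forestAdm_sorted_smul_of_connected (hkey : ∀ i, key i = key h → i = h)
    (hok : ∀ i j, key i = key j → ∀ p, (ok i p ↔ ok j p))
    (ht : ∀ i i' j j', key i = key i' → key j = key j' → ∀ p q, (touch i p j q ↔ touch i' p j' q))
    {c : I → Pos} (hokc : ∀ i, i ≠ h → ok i (c i)) (hsymm : ∀ i p j q, touch i p j q → touch j q i p)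
    (hconn : ∀ i, (SimpleGraph.fromRel fun i j => touch i (c i) j (c j)).Reachable h i) (hc : RootInj key ρ c) :
    ∃ σ : keyPerms key, (σ • c) h = c h ∧ ForestAdm ok touch h (σ • c) ∧ Sorted key ρ (σ • c) :=
  exists_forestAdm_sorted_smul hkey hok ht (forestAdm_of_connected hokc hsymm hconn) hc

end Connected

end Abstract

/-! ## §4 At the top join of a merger (the count's carriers: leaf-05 g2's `HistoryJoinsAdm.key`, `hostIdx`, `touch0`) -/

section TopJoin

open Literature.MathematicalPhysics.QuantumFieldTheory.Balaban1983to89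
open T4PersistenceDictionary T4PartnerMultiplicity T4BranchingRecordsGas
open Summit.QuantumFields.BalabanUV.T4Continuum.HistoryJoinsAdm
open Summit.QuantumFields.BalabanUV.T4Continuum.HistoryJoinsCount

open scoped Classical

variable {ε γ β R : Type*} [DecidableEq β] [LinearOrder R] {D : ℕ}
  (zone : ℕ → Gen ε → (Addr D → γ) → Finset β) (ρ : (Addr D → γ) → R) (st : ε → ℕ) (X Y : Gen ε) (e : ε)

omit [LinearOrder R] in
/-- `touch0` («the two parts' zones at the join step share a block») reads the parts only through their keys
(leaf-05 g2's `part_eq_of_key_eq`; cf. `HistoryJoinsCount.touchJ_iff_of_key_eq`). [folklore] -/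
theorem touch0_iff_of_key_eq {i i' j j' : Fin (npart st (Gen.merge X Y e))} (hi : key st X Y e i = key st X Y e i')
    (hj : key st X Y e j = key st X Y e j') (p q : Addr D → γ) :
    touch0 zone st X Y e i p j q ↔ touch0 zone st X Y e i' p j' q := by
  simp only [touch0, part_eq_of_key_eq st X Y e hi, part_eq_of_key_eq st X Y e hj]

omit [LinearOrder R] in
/-- `touch0` is symmetric [folklore] -/
theorem touch0_symm {i j : Fin (npart st (Gen.merge X Y e))} {p q : Addr D → γ}
    (h : touch0 zone st X Y e i p j q) : touch0 zone st X Y e j q i p := by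
  unfold touch0 at h ⊢
  rwa [inter_comm]

/-- **THE ρ-TIE-BREAK AT THE TOP JOIN OF A MERGER.**  A configuration of the parts' placements that is
forest-admissible around the host for `touch0` and root-injective within the classes of `HistoryJoinsAdm.key` has a
class-preserving relabelling satisfying BOTH clauses of `HistoryJoinsAdm.LocalTop` —
`ForestAdm (fun _ _ => True) (touch0 …) (hostIdx …) … ∧ Sorted (key …) ρ …` — with the host's placement unchanged;
it is unique among the sorting relabellings (`sorted_smul_unique`). [folklore] -/
theorem exists_localTop_smul {c : Fin (npart st (Gen.merge X Y e)) → (Addr D → γ)}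
    (hF : ForestAdm (fun _ _ => True) (touch0 zone st X Y e) (hostIdx st X Y e) c)
    (hc : RootInj (key st X Y e) ρ c) :
    ∃ σ : keyPerms (key st X Y e), (σ • c) (hostIdx st X Y e) = c (hostIdx st X Y e) ∧
      ForestAdm (fun _ _ => True) (touch0 zone st X Y e) (hostIdx st X Y e) (σ • c) ∧
        Sorted (key st X Y e) ρ (σ • c) :=
  exists_forestAdm_sorted_smul (eq_host_of_key_eq st X Y e) (fun _ _ _ _ => Iff.rfl)
    (fun _ _ _ _ hi hj p q => touch0_iff_of_key_eq zone st X Y e hi hj p q) hF hc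

/-- **THE SAME FROM CONNECTED CONTACT**: if the touch graph of the PLACED parts («zones at the join step share a
block») reaches every part from the host and the root read-outs are distinct within classes, a class-preserving
relabelling satisfying both clauses of `LocalTop` exists (host's placement unchanged). [folklore] -/
theorem exists_localTop_smul_of_connected {c : Fin (npart st (Gen.merge X Y e)) → (Addr D → γ)}
    (hconn : ∀ i, (SimpleGraph.fromRel fun i j => touch0 zone st X Y e i (c i) j (c j)).Reachable
      (hostIdx st X Y e) i)
    (hc : RootInj (key st X Y e) ρ c) :
    ∃ σ : keyPerms (key st X Y e), (σ • c) (hostIdx st X Y e) = c (hostIdx st X Y e) ∧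
      ForestAdm (fun _ _ => True) (touch0 zone st X Y e) (hostIdx st X Y e) (σ • c) ∧
        Sorted (key st X Y e) ρ (σ • c) :=
  exists_forestAdm_sorted_smul_of_connected (eq_host_of_key_eq st X Y e) (fun _ _ _ _ => Iff.rfl)
    (fun _ _ _ _ hi hj p q => touch0_iff_of_key_eq zone st X Y e hi hj p q) (fun _ _ => trivial)
    (fun _ _ _ _ h => touch0_symm zone st X Y e h) hconn hc

/-- **THE SAME IN THE `okJ` ∕ `touchJ` DRESS OF `HistoryJoinsCount`** (the instance seat's stated instantiation,
journal l.12347: `ok := okJ`, `touch := touchJ`): if moreover EVERY part — host included — is admissibly placed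
(`okJ`, i.e. its relative placement lies in `Sany` of its sub-structure), the relabelling is forest-admissible for
(`okJ`, `touchJ`) as well (`okJ` is key-invariant by leaf-05 g2's `okJ_iff_of_key_eq`; `forestAdm_enrich`).
[folklore] -/
theorem exists_localTopJ_smul_of_connected [Fintype γ] (c₀ : γ) {c : Fin (npart st (Gen.merge X Y e)) → (Addr D → γ)}
    (hok : ∀ i, okJ zone ρ c₀ st X Y e i (c i))
    (hconn : ∀ i, (SimpleGraph.fromRel fun i j => touch0 zone st X Y e i (c i) j (c j)).Reachable
      (hostIdx st X Y e) i)
    (hc : RootInj (key st X Y e) ρ c) :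
    ∃ σ : keyPerms (key st X Y e), (σ • c) (hostIdx st X Y e) = c (hostIdx st X Y e) ∧
      ForestAdm (okJ zone ρ c₀ st X Y e) (touchJ zone ρ c₀ st X Y e) (hostIdx st X Y e) (σ • c) ∧
        ForestAdm (fun _ _ => True) (touch0 zone st X Y e) (hostIdx st X Y e) (σ • c) ∧
          Sorted (key st X Y e) ρ (σ • c) := by
  obtain ⟨σ, hh, hF, hS⟩ := exists_localTop_smul_of_connected zone ρ st X Y e hconn hc
  have hok' : ∀ i, okJ zone ρ c₀ st X Y e i ((σ • c) i) := fun i => by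
    rw [smul_apply]
    exact (okJ_iff_of_key_eq (key_symm_apply σ i) _).1 (hok _)
  exact ⟨σ, hh, forestAdm_enrich hok' hF, hF, hS⟩

end TopJoin

/-! ## §5 Sanity (three parts, one class of two) -/

namespace Sanity

/-- on `Fin 3` with shape key `(0, 1, 1)` (host `0` alone, parts `1`, `2` in one class) the configuration `(0, 5, 3)`
in `ℕ` (read out by `id`) is root-injective and NOT sorted; the tie-break relabels it into a sorted one (namely
`(0, 3, 5)`: the two parts of the class swapped) -/
example : ¬ Sorted (![0, 1, 1] : Fin 3 → ℕ) (id : ℕ → ℕ) ![0, 5, 3] ∧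
    ∃ σ : keyPerms (![0, 1, 1] : Fin 3 → ℕ), Sorted (![0, 1, 1] : Fin 3 → ℕ) (id : ℕ → ℕ) (σ • ![0, 5, 3]) := by
  refine ⟨fun h => by simpa using h 1 2 (by simp) (by decide), exists_sorted_smul _ id ?_⟩
  intro i j hk hρ
  fin_cases i <;> fin_cases j <;> simp_all

end Sanity

end Summit.QuantumFields.BalabanUV.T4Continuum.HistorySiblingCanonExist
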